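import Mathlib
import Summits.NavierStokesRegularity.NavierStokesRegularity.Theorems.FilamentSkeletonRssStadiumConnectorBound
import Summits.NavierStokesRegularity.NavierStokesRegularity.Theorems.FilamentSkeletonRssStadiumClampIntegral
import Summits.NavierStokesRegularity.NavierStokesRegularity.Theorems.FilamentSkeletonRssStadiumConstants

/-!
# Connector bound in the concrete retype geometry (`TangentSkeletonNearStraightL`, stmt-NavierStokesRegularity-23320, registered stub
# `stub_stripPropagation` — blueprint item R6′, connectors, instantiated)

`16h ≤ hs`, `S₁₆ = {|Im| < h, |Re − c| < L + h}`, connectors at `x₀ = c ± P`, `P = L + 8h`, ratio 8, `M = 2`, `0 ≤ Rb ≤ 1/2`.  For every `z ∈ S₁₆`: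
  `‖∫_0^{Im z} K(z, x₀ + is) ds‖ ≤ h · ((7h)²·C)^{−3/2} · (8·(2L + 11h))`,
`C` the slope coefficient of Theorems.StadiumConstants (`≥ 3/8`) (`connector_norm_le_concrete`): Theorems.StadiumConnectorBound at `z₀ := z` with the ball
radius `min(h − |Im z|, L + h − |Re z − c|)`, both signs of `Im z` through Theorems.StadiumClampIntegral.  `O((L + h)/h²) = O(√(log Γ)/√Γ)` per unit
circulation.  HONEST FRAMING: bookkeeping for a HYPOTHETICAL filament skeleton on the NEGATIVE side of a MODEL route; nothing here bears on Navier–Stokes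
regularity or blow-up.  `--supports stmt-NavierStokesRegularity-23320`.
-/

set_option linter.dupNamespace false

noncomputable section

namespace Summit.NavierStokesRegularity.NavierStokesRegularity.Theorems.StadiumConnectorConcrete

open Set Metric MeasureTheory Complex
open scoped InnerProductSpace Matrix
open Summit.NavierStokesRegularity.NavierStokesRegularity.Theorems.StadiumConnectorBound
open Summit.NavierStokesRegularity.NavierStokesRegularity.Theorems.StadiumClampIntegral
open Summit.NavierStokesRegularity.NavierStokesRegularity.Theorems.StadiumConstants

/-- **Concrete connector bound.**  See the module docstring. [folklore] -/
theorem connector_norm_le_concrete {hs L cc Rb h κ Λ x₀ : ℝ} {F : ℂ → (Fin 3 → ℂ)} {G : ℂ → ℂ}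
    (hF : DifferentiableOn ℂ F {z : ℂ | |z.im| < hs ∧ |z.re - cc| < L + hs})
    (hunit : ∀ w ∈ {z : ℂ | |z.im| < hs ∧ |z.re - cc| < L + hs}, ∑ i, (deriv F w i) ^ 2 = 1)
    (hM : ∀ z ∈ {z : ℂ | |z.im| < hs ∧ |z.re - cc| < L + hs}, ‖deriv F z‖ ≤ 2)
    {X : ℝ → EuclideanSpace ℝ (Fin 3)} (hX : Differentiable ℝ X) (hXu : ∀ τ, ‖deriv X τ‖ = 1)
    (hRb0 : 0 ≤ Rb) (hRb : Rb ≤ 1 / 2) (hosc : ∀ τ σ, ‖deriv X τ - deriv X σ‖ ≤ Rb)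
    (hFX : ∀ r : ℝ, (r : ℂ) ∈ {z : ℂ | |z.im| < hs ∧ |z.re - cc| < L + hs} →
      F r = fun i => ((⟪X r, EuclideanSpace.single i (1:ℝ)⟫_ℝ : ℝ) : ℂ))
    (hGre : ∀ w ∈ {z : ℂ | |z.im| < hs ∧ |z.re - cc| < L + hs}, Λ⁻¹ / 2 ≤ (G w).re)
    (hκ : 0 < κ) (hΛ : 0 < Λ) (hh : 0 < h) (h16 : 16 * h ≤ hs)
    (hx₀ : |x₀ - cc| = L + 8 * h) {z : ℂ} (hz : |z.im| < h ∧ |z.re - cc| < L + h) :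
    ‖∫ s in (0:ℝ)..z.im, (((∑ i, (F z i - F ((x₀ : ℂ) + (s : ℂ) * I) i) ^ 2) + (κ : ℂ) * G ((x₀ : ℂ) + (s : ℂ) * I)) ^ ((3:ℂ) / 2))⁻¹ •
        (deriv F ((x₀ : ℂ) + (s : ℂ) * I) ⨯₃ (fun i => F z i - F ((x₀ : ℂ) + (s : ℂ) * I) i))‖ ≤
      h * (((7 * h) ^ 2 * ((1 - (2 / 7 : ℝ) ^ 2) * (1 - (Rb + 2 * (√3 * (2 * 2 * (Real.log ((8:ℝ) / (8 - 1)) - 1 / 8)))) ^ 2 / 2) -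
        2 * (2 / 7 : ℝ) * (2 * (√3 * (2 * Real.log ((8:ℝ) / (8 - 1)))) * (Rb + 2 * (√3 * (2 * 2 * (Real.log ((8:ℝ) / (8 - 1)) - 1 / 8))))))) ^ (-(3/2 : ℝ)) *
        (2 * 2 ^ 2 * (2 * L + 11 * h))) := by
  set P : ℝ := L + 8 * h with hP
  set C : ℝ := (1 - (2 / 7 : ℝ) ^ 2) * (1 - (Rb + 2 * (√3 * (2 * 2 * (Real.log ((8:ℝ) / (8 - 1)) - 1 / 8)))) ^ 2 / 2) -
        2 * (2 / 7 : ℝ) * (2 * (√3 * (2 * Real.log ((8:ℝ) / (8 - 1)))) * (Rb + 2 * (√3 * (2 * 2 * (Real.log ((8:ℝ) / (8 - 1)) - 1 / 8))))) with hCdef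
  have hA := ratio8_hA hRb0 hRb
  have hC : 0 < C := ratio8_hC hRb0 hRb (by norm_num : (0:ℝ) ≤ 2 / 7) le_rfl
  -- the ball of targets around `z`
  set δ : ℝ := min (h - |z.im|) (L + h - |z.re - cc|) with hδ
  have hδpos : 0 < δ := lt_min (by linarith [hz.1]) (by linarith [hz.2])
  have hδ1 : δ ≤ h - |z.im| := min_le_left _ _
  have hδ2 : δ ≤ L + h - |z.re - cc| := min_le_right _ _
  have hball : ∀ w ∈ ball z δ, |w.im| < h ∧ |w.re - cc| < L + h := by
    intro w hw
    rw [mem_ball, dist_eq_norm] at hw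
    have him : |w.im - z.im| < δ := lt_of_le_of_lt (by simpa using Complex.abs_im_le_norm (w - z)) hw
    have hre : |w.re - z.re| < δ := lt_of_le_of_lt (by simpa using Complex.abs_re_le_norm (w - z)) hw
    constructor
    · have := abs_add_le (w.im - z.im) z.im
      rw [show w.im - z.im + z.im = w.im by ring] at this; linarith
    · have := abs_add_le (w.re - z.re) (z.re - cc)
      rw [show w.re - z.re + (z.re - cc) = w.re - cc by ring] at this; linarith
  have hballS : ball z δ ⊆ {z : ℂ | |z.im| < hs ∧ |z.re - cc| < L + hs} := fun w hw =>
    ⟨by linarith [(hball w hw).1], by linarith [(hball w hw).2]⟩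
  have hballfit : ∀ w ∈ ball z δ, 8 * |w.im| < hs ∧ |w.re - cc| + 8 * |w.im| < L + hs := fun w hw =>
    ⟨by linarith [(hball w hw).1], by linarith [(hball w hw).1, (hball w hw).2]⟩
  have hfarz : ∀ w ∈ ball z δ, 7 * h ≤ |w.re - x₀| := by
    intro w hw
    have := abs_sub_abs_le_abs_sub (x₀ - cc) (w.re - cc)
    rw [hx₀, show x₀ - cc - (w.re - cc) = -(w.re - x₀) by ring, abs_neg] at this
    linarith [(hball w hw).2]
  have hzx₀ : |z.re - x₀| ≤ 2 * L + 9 * h := by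
    have := abs_sub_le (z.re) cc x₀
    rw [abs_sub_comm cc x₀, hx₀] at this
    linarith [hz.2]
  have hmono : ∀ {ℓ R₁ : ℝ}, 0 ≤ ℓ → ℓ ≤ h → 0 ≤ R₁ → R₁ ≤ 2 * L + 11 * h →
      ℓ * (((7 * h) ^ 2 * C) ^ (-(3/2 : ℝ)) * (2 * 2 ^ 2 * R₁)) ≤ h * (((7 * h) ^ 2 * C) ^ (-(3/2 : ℝ)) * (2 * 2 ^ 2 * (2 * L + 11 * h))) := by
    intro ℓ R₁ hℓ0 hℓ hR0 hR
    have hm : 0 ≤ ((7 * h) ^ 2 * C) ^ (-(3/2 : ℝ)) := Real.rpow_nonneg (by positivity) _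
    have h1 : ((7 * h) ^ 2 * C) ^ (-(3/2 : ℝ)) * (2 * 2 ^ 2 * R₁) ≤ ((7 * h) ^ 2 * C) ^ (-(3/2 : ℝ)) * (2 * 2 ^ 2 * (2 * L + 11 * h)) :=
      mul_le_mul_of_nonneg_left (by linarith) hm
    exact mul_le_mul hℓ h1 (by positivity) hh.le
  rcases le_total 0 z.im with hy | hy
  · -- `Im z ≥ 0`: connector parameters `[0, Im z]`
    have hcoS : ∀ t ∈ Icc 0 z.im, ((x₀ : ℂ) + (t : ℂ) * Complex.I) ∈ {z : ℂ | |z.im| < hs ∧ |z.re - cc| < L + hs} := by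
      intro t ht
      have : |t| ≤ |z.im| := by rw [abs_of_nonneg ht.1, abs_of_nonneg hy]; exact ht.2
      exact ⟨by simpa using (by linarith [hz.1] : |t| < hs), by simpa [hx₀] using (by linarith : P < L + hs)⟩
    have hcofit : ∀ t ∈ Icc 0 z.im, 8 * |t| < hs ∧ |x₀ - cc| + 8 * |t| < L + hs := by
      intro t ht
      have : |t| ≤ |z.im| := by rw [abs_of_nonneg ht.1, abs_of_nonneg hy]; exact ht.2
      exact ⟨by linarith [hz.1], by rw [hx₀]; linarith [hz.1]⟩
    have hheights : ∀ w ∈ ball z δ, ∀ t ∈ Icc 0 z.im, |w.im - t| ≤ 2 / 7 * (7 * h) := by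
      intro w hw t ht
      have h1 : |t| ≤ |z.im| := by rw [abs_of_nonneg ht.1, abs_of_nonneg hy]; exact ht.2
      have := abs_sub (w.im) t
      linarith [(hball w hw).1, hz.1]
    have hb := connector_norm_le (n := 8) (M := 2) (m := 2 / 7) (r₀ := 7 * h) hF hunit hM hX hXu hosc hFX hGre (by norm_num) hκ hΛ hy
      hcoS hcofit hballS hballfit (by norm_num) (by norm_num) (by positivity) hfarz hheights hA hC z (mem_ball_self hδpos)
    rw [← hCdef] at hb
    rw [← setIntegral_clamp_eq_intervalIntegral _ hy]
    refine hb.trans ?_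
    have e : |z.im - 0| + |z.im - z.im| = |z.im| := by simp
    rw [e]
    have hl0 : (0:ℝ) ≤ z.im - 0 := by linarith
    have hl1 : z.im - 0 ≤ h := by
      have : |z.im| = z.im := abs_of_nonneg hy
      linarith [hz.1]
    exact hmono hl0 hl1 (by positivity) (by linarith [hz.1])
  · -- `Im z ≤ 0`: connector parameters `[Im z, 0]`
    have hcoS : ∀ t ∈ Icc z.im 0, ((x₀ : ℂ) + (t : ℂ) * Complex.I) ∈ {z : ℂ | |z.im| < hs ∧ |z.re - cc| < L + hs} := by
      intro t ht
      have : |t| ≤ |z.im| := by rw [abs_of_nonpos ht.2, abs_of_nonpos hy]; linarith [ht.1]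
      exact ⟨by simpa using (by linarith [hz.1] : |t| < hs), by simpa [hx₀] using (by linarith : P < L + hs)⟩
    have hcofit : ∀ t ∈ Icc z.im 0, 8 * |t| < hs ∧ |x₀ - cc| + 8 * |t| < L + hs := by
      intro t ht
      have : |t| ≤ |z.im| := by rw [abs_of_nonpos ht.2, abs_of_nonpos hy]; linarith [ht.1]
      exact ⟨by linarith [hz.1], by rw [hx₀]; linarith [hz.1]⟩
    have hheights : ∀ w ∈ ball z δ, ∀ t ∈ Icc z.im 0, |w.im - t| ≤ 2 / 7 * (7 * h) := by
      intro w hw t ht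
      have h1 : |t| ≤ |z.im| := by rw [abs_of_nonpos ht.2, abs_of_nonpos hy]; linarith [ht.1]
      have := abs_sub (w.im) t
      linarith [(hball w hw).1, hz.1]
    have hb := connector_norm_le (n := 8) (M := 2) (m := 2 / 7) (r₀ := 7 * h) hF hunit hM hX hXu hosc hFX hGre (by norm_num) hκ hΛ hy
      hcoS hcofit hballS hballfit (by norm_num) (by norm_num) (by positivity) hfarz hheights hA hC z (mem_ball_self hδpos)
    rw [← hCdef] at hb
    rw [intervalIntegral_eq_neg_setIntegral_clamp _ hy, norm_neg]
    refine hb.trans ?_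
    have e : |z.im - z.im| + |z.im - 0| = |z.im| := by simp
    rw [e]
    have hl1 : 0 - z.im ≤ h := by
      have : |z.im| = -z.im := abs_of_nonpos hy
      linarith [hz.1]
    exact hmono (by linarith) hl1 (by positivity) (by linarith [hz.1])

end Summit.NavierStokesRegularity.NavierStokesRegularity.Theorems.StadiumConnectorConcrete

end
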